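import Mathlib
import HarnessLib
import Literature.Combinatorics.Additive.KempermanDecompositionExistence
import Literature.Combinatorics.Additive.FullGroupCriticalPairs

/-!
# The Kemperman Structure Theorem, «only if» half (Kemperman 1960, Theorem 5.1, necessity)

[cite: Kemperman1960, Thm 5.1] [tag: critical-pair] [tag: inverse-theorem]

Topic `Literature/Combinatorics/Additive`.  Cell `mm-stpp` (D-0046), seat `mm-stpp-lit` (gen 22).
THE BRIDGE from the tree's Boothby–DeVos–Montejano form of Kemperman's theorem to the
quasi-periodic-decomposition form of Kemperman 1960 / Grynkiewicz 2005 (the «only if» half of KST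
as used in Grynkiewicz 2009 §2, in Kemperman's form `IsKempermanDecompI`, i.e. without Grynkiewicz's
2009 condition (iii)), completed: `KempermanDecompositionExistence.lean` did the aperiodic branch;
this file does the periodic branch and states the theorem.

SOURCE.  J. H. B. Kemperman, *On small sumsets in an abelian group*, Acta Math. **103** (1960)
63–88, §5 THEOREM 5.1 (pp. 78–79 = p0016 L60 – p0017 L22 of the held text
`paper:doi-10-1007-bf02546525`): «Let `A`, `B` be finite non-empty subsets of `G` satisfying (1)
[`|A + B| ≤ |A| + |B| − 1`] and, moreover, (2) if `A + B` is periodic then `ν_c(A, B) = 1` for at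
least one `c`.  Necessary and sufficient … is the existence of a non-empty subset `A₁` of `A`, a
non-empty subset `B₁` of `B` and a subgroup `F` of `G` of order `|F| ≥ 2`, such that: (i) The pair
`(A₁, B₁)` is elementary, each of `A₁`, `B₁` is contained in an `F`-coset. (ii) The element
`σA₁ + σB₁` has `σA₁ + σB₁` as its only representation of the form `ā + b̄`, `ā ∈ σA`, `b̄ ∈ σB` …
(iii) The complement `A'` of `A₁` in `A` satisfies `A' + F = A'`, similarly … (iv) Finally,
`|σA + σB| = |σA| + |σB| − 1`.»; the periodic branch is Kemperman's remark after Lemma 4.5 (p. 77: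
«Suppose that (3) holds and that `A + B` is periodic but not the coset of a finite group. If
`ν_c(A, B) = 1` has a solution `c` … then Lemma 3.3 easily implies `(H, c + H) ∈ P₁(A, B)`, where
`H = H(A + B)`») together with his case (i) of Lemma 5.2 (`FullGroupCriticalPairs.lean`).
D. J. Grynkiewicz, *Quasi-periodic decompositions and the Kemperman structure theorem*, European
J. Combin. 26 (2005), §2 states it as «KST I» with `|A + B| = |A| + |B| − 1`.

MAIN RESULTS (0 named facts; everything PROVED).
* `exists_isKempermanDecompI` — **KST, «only if»**: `G` finite nontrivial abelian, `A, B ≠ ∅`,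
  `|A + B| = |A| + |B| − 1`, `A + B` aperiodic or `∃ c, ν_c(A, B) = 1` ⟹
  `∃ H A₁ A₀ B₁ B₀, IsKempermanDecompI H A B A₁ A₀ B₁ B₀`.
* `exists_isKempermanDecompI_of_isPeriodic` — the periodic branch.
* `isElementaryPair_of_not_isQuasiPeriodic` — a critical pair whose sum is neither periodic nor
  quasi-periodic is elementary (Kemperman Lemma 5.2; the use of KST in Grynkiewicz 2009 Lemma 5.9).
* `isKempermanDecompI_iff` — **Kemperman's Theorem 5.1 as an equivalence** (gen 23 append): the «if»
  half (`IsKempermanDecompI.card_add`, `IsKempermanDecompI.not_isPeriodic_or_exists`, the proofs of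
  `KempermanElementaryPairs.lean` §IsKempermanDecomp repeated for Kemperman's form) joined to
  `exists_isKempermanDecompI`.
* helpers `addConvolution_mono`, `cosetCount_add_carrier`, `add_eq_carrier_of_card_lt` (pigeonhole
  in a finite subgroup).
(`-- TODO(general form)`: infinite abelian `G`; Kemperman's (1) with `≤` in the periodic branch
needs Kemperman–Scherk; Grynkiewicz 2009's condition (iii) — Grynkiewicz 2005 (c.10)/Prop. 2.2.)

PROOF of the periodic branch (ours for the bookkeeping).  `S = stab(A + B)`, `|S| ≥ 2`, `c₀ = a + b`
the unique expression.  Kneser's equality (`Grynkiewicz.kneser_eq_of_card_add_lt`)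
`|A + S| + |B + S| = |A + B| + |S|` gives `(|A + S| − |A|) + (|B + S| − |B|) = |S| − 1` holes;
uniqueness of `c₀` gives `|A ∩ (a + S)| + |B ∩ (b + S)| ≤ |S| + 1` (the sets `A ∩ (a+S) − a` and
`b − B ∩ (b+S)` meet only in `0`), i.e. `≥ |S| − 1` holes inside the cosets `a + S`, `b + S`; hence all
holes are there: `A ∖ (a + S) = (A + S) ∖ (a + S)` and `B ∖ (b + S)` are `S`-periodic, and
`|A ∩ (a+S)| + |B ∩ (b+S)| = |S| + 1`.  This is coarse data relative to `S` (Kemperman's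
`(H, c₀ + H) ∈ P₁(A, B)`): (i) a sum `a' + b' ≡ c₀ (mod S)` with `a' ∉ a + S` would put `c₀ − b'` in the
periodic part through `a'`, a second representation of `c₀`; (ii) divide Kneser's equality by `|S|`.
The bottom pair, translated into `S`, sums to all of `S` (pigeonhole) with `0` uniquely expressed, so
`exists_isKempermanDecompI_of_add_eq_univ` in `↥S` (nontrivial), transported back by
`IsKempermanDecompI.of_toSub` and `IsKempermanDecompI.vadd`, feeds `exists_isKempermanDecompI_of_coarse`.

## References
* J. H. B. Kemperman, *On small sumsets in an abelian group*, Acta Math. 103 (1960) 63–88,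
  doi:10.1007/BF02546525, §§4–5 (Theorem 5.1 pp. 78–81; remark after Lemma 4.5 p. 77) — held
  `paper:doi-10-1007-bf02546525`, p0015–p0019 read 2026-08-29 [cite: Kemperman1960, Thm 5.1].
* D. J. Grynkiewicz, *Quasi-periodic decompositions and the Kemperman structure theorem*, European
  J. Combin. 26 (2005) 559–575, §2 (KST I) [cite: Grynkiewicz2005, §2].
* D. J. Grynkiewicz, *A step beyond Kemperman's structure theorem*, Mathematika 55 (2009) 67–114, §2
  [cite: Grynkiewicz2009, §2].
* T. Boothby, M. DeVos, A. Montejano, *A new proof of Kemperman's theorem*, Integers 15 (2015) #A5,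
  arXiv:1301.0095 [cite: BoothbyDevosMontejano2013, Thm 4.5].
-/

namespace Literature.Combinatorics.Additive

open Finset
open scoped Pointwise

universe u

section Helpers

variable {G : Type*} [AddCommGroup G] [DecidableEq G]

/-- `ν` is monotone in both sets. [cite: Kemperman1960, §3] -/
theorem addConvolution_mono {A A' B B' : Finset G} (hA : A' ⊆ A) (hB : B' ⊆ B) (c : G) :
    A'.addConvolution B' c ≤ A.addConvolution B c := by
  rw [addConvolution_eq_card_filter, addConvolution_eq_card_filter]
  exact card_le_card fun b hb => by
    rw [mem_filter] at hb ⊢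
    exact ⟨hB hb.1, hA hb.2⟩

/-- `A + H` meets the same `H`-cosets as `A`. [cite: Kemperman1960, §3] -/
theorem cosetCount_add_carrier {H : AddSubgroup G} {Hf : Finset G} (hHf : ∀ g, g ∈ Hf ↔ g ∈ H)
    (A : Finset G) : cosetCount H (A + Hf) = cosetCount H A := by
  classical
  rw [cosetCount_eq_card_image, cosetCount_eq_card_image]
  congr 1
  ext q
  simp only [mem_image, mem_add]
  constructor
  · rintro ⟨x, ⟨a, ha, h, hh, rfl⟩, rfl⟩
    refine ⟨a, ha, ?_⟩
    rw [QuotientAddGroup.eq]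
    have e : -a + (a + h) = h := by abel
    rw [e]; exact (hHf h).1 hh
  · rintro ⟨a, ha, rfl⟩
    exact ⟨a + 0, ⟨a, ha, 0, (hHf 0).2 H.zero_mem, rfl⟩, by rw [add_zero]⟩

/-- Pigeonhole: two subsets of a finite subgroup `H` of total size `> |H|` sum to all of `H`.
[cite: Kemperman1960, §3] -/
theorem add_eq_carrier_of_card_lt {H : Finset G} (hH : IsSubgroupCarrier H) {X Y : Finset G}
    (hX : X ⊆ H) (hY : Y ⊆ H) (hcard : #H < #X + #Y) : X + Y = H := by
  refine Subset.antisymm (fun z hz => ?_) (fun z hz => ?_)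
  · obtain ⟨x, hx, y, hy, rfl⟩ := mem_add.1 hz
    exact hH.add_mem (hX hx) (hY hy)
  · -- `X` and `z − Y` are subsets of `H` of total size `> |H|`
    have hY' : (Y.image fun y => z - y) ⊆ H := by
      intro u hu
      obtain ⟨y, hy, rfl⟩ := mem_image.1 hu
      exact hH.sub_mem hz (hY hy)
    have hc : #(Y.image fun y => z - y) = #Y :=
      card_image_of_injective _ fun x y (h : z - x = z - y) => sub_right_injective h
    have hne : (X ∩ Y.image fun y => z - y).Nonempty := by
      rw [← card_pos]
      have h1 := card_union_add_card_inter X (Y.image fun y => z - y)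
      have h2 := card_le_card (union_subset hX hY')
      omega
    obtain ⟨x, hx⟩ := hne
    rw [mem_inter, mem_image] at hx
    obtain ⟨hxX, y, hy, hyx⟩ := hx
    exact mem_add.2 ⟨x, hxX, y, hy, by rw [← hyx, sub_add_cancel]⟩

end Helpers

section Periodic

variable {G : Type u} [AddCommGroup G] [Fintype G] [DecidableEq G]

/-- **The periodic branch** (Kemperman 1960: the remark after Lemma 4.5 «Suppose that (3) holds and
that `A + B` is periodic but not the coset of a finite group. If `ν_c(A, B) = 1` has a solution `c` …
then Lemma 3.3 easily implies `(H, c + H) ∈ P₁(A, B)`, where `H = H(A + B)`», followed by the proof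
of Theorem 5.1): `|A + B| = |A| + |B| − 1`, `A + B` periodic, `ν_{c₀}(A, B) = 1` ⟹ a decomposition
(i)–(iv).  PROOF (ours for the reduction): with `S = stab(A + B)` (`|S| ≥ 2`) and `c₀ = a + b`:
Kneser's equality `|A + S| + |B + S| = |A + B| + |S|` bounds the holes `|A + S| − |A| + |B + S| − |B|
= |S| − 1`, while uniqueness of `c₀` gives `|A ∩ (a + S)| + |B ∩ (b + S)| ≤ |S| + 1`, i.e. at least
`|S| − 1` holes inside the two cosets `a + S`, `b + S`; so all holes are there, `A ∖ (a + S)` and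
`B ∖ (b + S)` are `S`-periodic, and `(S, c₀ + S)` is coarse data whose bottom pair
`(A ∩ (a + S), B ∩ (b + S))` has `|·| + |·| = |S| + 1`, hence sums to the whole coset `c₀ + S` with
`c₀` uniquely expressed: `FullGroupCriticalPairs` inside `↥S` (transport `IsKempermanDecompI.of_toSub`,
translation `IsKempermanDecompI.vadd`) and `exists_isKempermanDecompI_of_coarse`.
[cite: Kemperman1960, Thm 5.1; Lemma 4.5 (remark)] -/
theorem exists_isKempermanDecompI_of_isPeriodic {A B : Finset G} (hA : A.Nonempty) (hB : B.Nonempty)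
    (hcrit : #(A + B) + 1 = #A + #B) (hper : IsPeriodic (A + B)) {c₀ : G}
    (hc₀ : A.addConvolution B c₀ = 1) :
    ∃ (H : AddSubgroup G) (A₁ A₀ B₁ B₀ : Finset G), IsKempermanDecompI H A B A₁ A₀ B₁ B₀ := by
  classical
  set Sf := (A + B).addStab with hSfdef
  have hS : IsSubgroupCarrier Sf := IsSubgroupCarrier.of_addStab (hA.add hB)
  set S' : AddSubgroup G := hS.toAddSubgroup
  have hSf : ∀ g, g ∈ Sf ↔ g ∈ S' := fun g => hS.mem_toAddSubgroup.symm
  have memS : ∀ {g}, g ∈ Sf → g ∈ S' := fun hg => (hSf _).1 hg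
  have h2S : 2 ≤ #Sf := by
    have hne : Sf ≠ {0} := (isPeriodic_iff_addStab_ne (hA.add hB)).1 hper
    have h0 : (0 : G) ∈ Sf := hS.zero_mem
    by_contra hlt
    have h1 : #Sf ≤ 1 := by omega
    exact hne (eq_singleton_iff_unique_mem.2 ⟨h0, fun x hx => card_le_one.1 h1 x hx 0 h0⟩)
  have hS'b : S' ≠ ⊥ := by
    intro hbot
    have hsub : Sf ⊆ {0} := fun x hx => by
      have := memS hx
      rw [hbot, AddSubgroup.mem_bot] at this
      exact mem_singleton.2 this
    have := card_le_card hsub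
    rw [card_singleton] at this
    omega
  -- the unique expression `c₀ = a + b`
  obtain ⟨b, hb, haA, huniq⟩ := addConvolution_eq_one_iff.1 hc₀
  set a := c₀ - b with hadef
  have hab : a + b = c₀ := by rw [hadef, sub_add_cancel]
  -- Kneser's equality and the hole count
  have hkn := Grynkiewicz.kneser_eq_of_card_add_lt hA hB (by omega)
  rw [← hSfdef] at hkn
  set A₀ := A ∩ (a +ᵥ Sf)
  set B₀ := B ∩ (b +ᵥ Sf)
  have hA₀sub : A₀ ⊆ a +ᵥ Sf := inter_subset_right
  have hB₀sub : B₀ ⊆ b +ᵥ Sf := inter_subset_right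
  have ha₀ : a ∈ A₀ := mem_inter.2 ⟨haA, hS.mem_coset_self a⟩
  have hb₀ : b ∈ B₀ := mem_inter.2 ⟨hb, hS.mem_coset_self b⟩
  -- (R2) `|A₀| + |B₀| ≤ |S| + 1`
  have hR2 : #A₀ + #B₀ ≤ #Sf + 1 := by
    set U := A₀.image fun x => x - a
    set V := B₀.image fun y => b - y
    have hU : #U = #A₀ := card_image_of_injective _ (sub_left_injective)
    have hV : #V = #B₀ := card_image_of_injective _ fun x y (h : b - x = b - y) => sub_right_injective h
    have hUV : U ∪ V ⊆ Sf := by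
      intro s hs
      rcases mem_union.1 hs with hs | hs
      · obtain ⟨x, hx, rfl⟩ := mem_image.1 hs
        exact (hS.mem_coset_iff).1 (hA₀sub hx)
      · obtain ⟨y, hy, rfl⟩ := mem_image.1 hs
        have := (hS.mem_coset_iff).1 (hB₀sub hy)
        have e : b - y = -(y - b) := by abel
        rw [e]; exact hS.neg_mem this
    have hint : U ∩ V ⊆ {0} := by
      intro s hs
      rw [mem_inter] at hs
      obtain ⟨x, hx, hxs⟩ := mem_image.1 hs.1
      obtain ⟨y, hy, hys⟩ := mem_image.1 hs.2
      rw [mem_singleton]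
      -- `x + y = c₀`
      have hxy : x + y = c₀ := by
        have h : x - a = b - y := by rw [hxs, hys]
        calc x + y = (x - a) + a + y := by abel
          _ = (b - y) + a + y := by rw [h]
          _ = c₀ := by rw [← hab]; abel
      have := huniq y (mem_inter.1 hy).1 (by rw [← hxy, add_sub_cancel_right]; exact (mem_inter.1 hx).1)
      rw [← hys, this, sub_self]
    have h1 := card_union_add_card_inter U V
    have h2 := card_le_card hUV
    have h3 := card_le_card hint
    rw [card_singleton] at h3
    omega
  -- holes in the two cosets versus all holes
  have hAsub : A ⊆ A + Sf := hS.subset_add A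
  have hBsub : B ⊆ B + Sf := hS.subset_add B
  have haSf : (a +ᵥ Sf) \ A ⊆ (A + Sf) \ A := sdiff_subset_sdiff
    (fun x hx => by obtain ⟨s, hs, rfl⟩ := mem_vadd_finset.1 hx; exact mem_add.2 ⟨a, haA, s, hs, rfl⟩)
    Subset.rfl
  have hbSf : (b +ᵥ Sf) \ B ⊆ (B + Sf) \ B := sdiff_subset_sdiff
    (fun x hx => by obtain ⟨s, hs, rfl⟩ := mem_vadd_finset.1 hx; exact mem_add.2 ⟨b, hb, s, hs, rfl⟩)
    Subset.rfl
  have cA : #((a +ᵥ Sf) \ A) = #Sf - #A₀ := by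
    have : (a +ᵥ Sf) \ A = (a +ᵥ Sf) \ A₀ := by
      ext x; simp only [mem_sdiff, mem_inter, A₀]; tauto
    rw [this, card_sdiff_of_subset hA₀sub, card_vadd_finset]
  have cB : #((b +ᵥ Sf) \ B) = #Sf - #B₀ := by
    have : (b +ᵥ Sf) \ B = (b +ᵥ Sf) \ B₀ := by
      ext x; simp only [mem_sdiff, mem_inter, B₀]; tauto
    rw [this, card_sdiff_of_subset hB₀sub, card_vadd_finset]
  have cA' : #((A + Sf) \ A) = #(A + Sf) - #A := card_sdiff_of_subset hAsub
  have cB' : #((B + Sf) \ B) = #(B + Sf) - #B := card_sdiff_of_subset hBsub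
  have lA := card_le_card haSf
  have lB := card_le_card hbSf
  have hA₀le : #A₀ ≤ #Sf := by
    have := card_le_card hA₀sub; rwa [card_vadd_finset] at this
  have hB₀le : #B₀ ≤ #Sf := by
    have := card_le_card hB₀sub; rwa [card_vadd_finset] at this
  have hAle : #A ≤ #(A + Sf) := card_le_card hAsub
  have hBle : #B ≤ #(B + Sf) := card_le_card hBsub
  have eqA : (a +ᵥ Sf) \ A = (A + Sf) \ A := eq_of_subset_of_card_le haSf (by omega)
  have eqB : (b +ᵥ Sf) \ B = (B + Sf) \ B := eq_of_subset_of_card_le hbSf (by omega)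
  have hsize : #A₀ + #B₀ = #Sf + 1 := by omega
  -- periodic parts
  have hperS : ∀ X : Finset G, IsPeriodicWith S' (X + Sf) := fun X =>
    (isPeriodicWith_iff_add_eq hSf).2 (hS.add_add_self X)
  have hA1eq : A \ (a +ᵥ Sf) = (A + Sf) \ (a +ᵥ Sf) := by
    refine Subset.antisymm (sdiff_subset_sdiff hAsub Subset.rfl) fun x hx => ?_
    rw [mem_sdiff] at hx ⊢
    refine ⟨?_, hx.2⟩
    by_contra hxA
    have : x ∈ (A + Sf) \ A := mem_sdiff.2 ⟨hx.1, hxA⟩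
    rw [← eqA, mem_sdiff] at this
    exact hx.2 this.1
  have hB1eq : B \ (b +ᵥ Sf) = (B + Sf) \ (b +ᵥ Sf) := by
    refine Subset.antisymm (sdiff_subset_sdiff hBsub Subset.rfl) fun x hx => ?_
    rw [mem_sdiff] at hx ⊢
    refine ⟨?_, hx.2⟩
    by_contra hxB
    have : x ∈ (B + Sf) \ B := mem_sdiff.2 ⟨hx.1, hxB⟩
    rw [← eqB, mem_sdiff] at this
    exact hx.2 this.1
  have hA1 : IsPeriodicWith S' (A \ (a +ᵥ Sf)) := by
    rw [hA1eq]; exact (hperS A).sdiff (isPeriodicWith_vadd_carrier hSf a)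
  have hB1 : IsPeriodicWith S' (B \ (b +ᵥ Sf)) := by
    rw [hB1eq]; exact (hperS B).sdiff (isPeriodicWith_vadd_carrier hSf b)
  have cosA : ∀ x ∈ A₀, ∀ y ∈ A₀, x - y ∈ S' := fun x hx y hy => by
    obtain ⟨u, hu, rfl⟩ := mem_vadd_finset.1 (hA₀sub hx)
    obtain ⟨v, hv, rfl⟩ := mem_vadd_finset.1 (hA₀sub hy)
    rw [vadd_eq_add, vadd_eq_add, add_sub_add_left_eq_sub]; exact S'.sub_mem (memS hu) (memS hv)
  have cosB : ∀ x ∈ B₀, ∀ y ∈ B₀, x - y ∈ S' := fun x hx y hy => by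
    obtain ⟨u, hu, rfl⟩ := mem_vadd_finset.1 (hB₀sub hx)
    obtain ⟨v, hv, rfl⟩ := mem_vadd_finset.1 (hB₀sub hy)
    rw [vadd_eq_add, vadd_eq_add, add_sub_add_left_eq_sub]; exact S'.sub_mem (memS hu) (memS hv)
  have hdA : IsQuasiPeriodicDecomp S' A (A \ (a +ᵥ Sf)) A₀ :=
    ⟨hS'b, disjoint_sdiff_inter _ _, sdiff_union_inter _ _, hA1, cosA⟩
  have hdB : IsQuasiPeriodicDecomp S' B (B \ (b +ᵥ Sf)) B₀ :=
    ⟨hS'b, disjoint_sdiff_inter _ _, sdiff_union_inter _ _, hB1, cosB⟩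
  -- (i)
  have hi : ∀ a' ∈ A, ∀ b' ∈ B, ∀ x ∈ A₀, ∀ y ∈ B₀, (a' + b') - (x + y) ∈ S' →
      a' - x ∈ S' ∧ b' - y ∈ S' := by
    intro a' ha' b' hb' x hx y hy hq
    have hxa : x - a ∈ S' := cosA x hx a ha₀
    have hyb : y - b ∈ S' := cosB y hy b hb₀
    have hc : a' + b' - c₀ ∈ S' := by
      have e : a' + b' - c₀ = (a' + b' - (x + y)) + (x - a) + (y - b) := by rw [← hab]; abel
      rw [e]; exact S'.add_mem (S'.add_mem hq hxa) hyb
    have haa : a' - a ∈ S' := by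
      by_contra hnot
      have hout : a' ∈ A \ (a +ᵥ Sf) := mem_sdiff.2 ⟨ha', fun h => hnot (by
        obtain ⟨s, hs, rfl⟩ := mem_vadd_finset.1 h
        rw [vadd_eq_add, add_sub_cancel_left]; exact memS hs)⟩
      -- `c₀ − b' ≡ a'` lies in the periodic part, giving a second representation of `c₀`
      have hz : c₀ - b' ∈ A \ (a +ᵥ Sf) := by
        have e : c₀ - b' = -(a' + b' - c₀) + a' := by abel
        rw [e]; exact hA1.add_mem (S'.neg_mem hc) hout
      have hb'b : b' = b := huniq b' hb' (mem_sdiff.1 hz).1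
      apply hnot
      have e : a' - a = a' + b' - c₀ := by rw [hb'b, ← hab]; abel
      rw [e]; exact hc
    refine ⟨?_, ?_⟩
    · have e : a' - x = (a' - a) - (x - a) := by abel
      rw [e]; exact S'.sub_mem haa hxa
    · have e : b' - y = (a' + b' - c₀) - (a' - a) - (y - b) := by rw [← hab]; abel
      rw [e]; exact S'.sub_mem (S'.sub_mem hc haa) hyb
  -- (ii)
  have hii : cosetCount S' (A + B) + 1 = cosetCount S' A + cosetCount S' B := by
    have hABper : IsPeriodicWith S' (A + B) := by
      have := hperS (A + B)
      rwa [show A + B + Sf = A + B from add_addStab (A + B)] at this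
    have e1 := card_eq_cosetCount_mul hSf hABper
    have e2 := card_eq_cosetCount_mul hSf (hperS A)
    have e3 := card_eq_cosetCount_mul hSf (hperS B)
    rw [cosetCount_add_carrier hSf] at e2 e3
    rw [e1, e2, e3] at hkn
    have hpos : 0 < #Sf := by omega
    apply Nat.eq_of_mul_eq_mul_right hpos
    rw [add_mul, one_mul, add_mul]
    omega
  -- the bottom pair inside `S`
  haveI : Fintype ↥S' := Fintype.ofFinite _
  set X := (-a) +ᵥ A₀ with hXdef
  set Y := (-b) +ᵥ B₀ with hYdef
  have hXS : X ⊆ Sf := by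
    intro x hx
    obtain ⟨u, hu, rfl⟩ := mem_vadd_finset.1 hx
    have := (hS.mem_coset_iff).1 (hA₀sub hu)
    have e : -a +ᵥ u = u - a := by rw [vadd_eq_add]; abel
    rw [e]; exact this
  have hYS : Y ⊆ Sf := by
    intro y hy
    obtain ⟨u, hu, rfl⟩ := mem_vadd_finset.1 hy
    have := (hS.mem_coset_iff).1 (hB₀sub hu)
    have e : -b +ᵥ u = u - b := by rw [vadd_eq_add]; abel
    rw [e]; exact this
  have cv : ∀ {W : Finset G}, W ⊆ Sf → (W : Set G) ⊆ S' := fun hW y hy => memS (hW (mem_coe.1 hy))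
  have hXY : X + Y = Sf := add_eq_carrier_of_card_lt hS hXS hYS (by
    rw [hXdef, hYdef, card_vadd_finset, card_vadd_finset]; omega)
  have hSuniv : toSub S' Sf = univ := eq_univ_of_forall fun x => mem_toSub.2 ((hSf x).2 x.2)
  have hcardS : Fintype.card ↥S' = #Sf := by
    rw [← card_univ, ← hSuniv, card_toSub (cv Subset.rfl)]
  haveI : Nontrivial ↥S' := by
    rw [← Fintype.one_lt_card_iff_nontrivial, hcardS]; omega
  have hsumS : toSub S' X + toSub S' Y = univ := by rw [← toSub_add (cv hXS) (cv hYS), hXY, hSuniv]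
  have hcritS : #(toSub S' X + toSub S' Y) + 1 = #(toSub S' X) + #(toSub S' Y) := by
    rw [← toSub_add (cv hXS) (cv hYS), card_toSub (cv hXS), card_toSub (cv hYS),
      card_toSub (coe_add_subset (cv hXS) (cv hYS)), hXY, hXdef, hYdef, card_vadd_finset,
      card_vadd_finset]
    omega
  -- the unique expression element `0 = (a − a) + (b − b)` of `(X, Y)`
  have h0S : (0 : G) ∈ S' := S'.zero_mem
  have hr0 : (toSub S' X).addConvolution (toSub S' Y) ⟨0, h0S⟩ = 1 := by
    rw [addConvolution_toSub (cv hXS)]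
    change X.addConvolution Y 0 = 1
    rw [hXdef, hYdef, addConvolution_vadd_vadd]
    have e : (0 : G) - -a - -b = c₀ := by rw [← hab]; abel
    rw [e]
    apply le_antisymm
    · rw [← hc₀]; exact addConvolution_mono inter_subset_left inter_subset_left c₀
    · rw [addConvolution_eq_card_filter]
      exact card_pos.2 ⟨b, mem_filter.2 ⟨hb₀, ha₀⟩⟩
  obtain ⟨L, X₁, X₀, Y₁, Y₀, hL⟩ := exists_isKempermanDecompI_of_add_eq_univ hsumS hcritS hr0
  have hG := hL.of_toSub (cv hXS) (cv hYS)
  have hG' := hG.vadd a b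
  rw [hXdef, hYdef, vadd_neg_vadd, vadd_neg_vadd] at hG'
  exact exists_isKempermanDecompI_of_coarse hSf hdA hdB hi hii hG'

end Periodic

section KST

variable {G : Type u} [AddCommGroup G] [Fintype G] [DecidableEq G]

/-- **THE KEMPERMAN STRUCTURE THEOREM, «only if» half** (Kemperman 1960, Theorem 5.1, necessity;
Grynkiewicz 2005 «KST I»; the form used in Grynkiewicz 2009 §2, without his added condition (iii)):
in a finite nontrivial abelian group, if `A, B ≠ ∅`, `|A + B| = |A| + |B| − 1`, and `A + B` is
aperiodic or some `c` has `ν_c(A, B) = 1`, then there are quasi-periodic decompositions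
`A = A₁ ∪ A₀`, `B = B₁ ∪ B₀` with a common quasi-period `H` (`A₀, B₀ ≠ ∅`) such that (i)
`φ_H(A₀) + φ_H(B₀)` is a unique expression element in `φ_H(A) + φ_H(B)`, (ii)
`|φ_H(A + B)| = |φ_H(A)| + |φ_H(B)| − 1`, (iv) `(A₀, B₀)` is an elementary pair of type (I)–(IV)
(`IsKempermanDecompI`).  Kemperman's own hypothesis (1) is `|A + B| ≤ |A| + |B| − 1`; with (2) it
forces equality (Kneser for an aperiodic sum — `exists_isKempermanDecompI_of_not_isPeriodic'` —,
Kemperman–Scherk for a unique expression element), so equality is assumed here as in Grynkiewicz's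
statement (`-- TODO(general form)`: infinite abelian `G`; Grynkiewicz 2009's condition (iii)).
PROOF: `exists_isKempermanDecompI_of_not_isPeriodic` (the walk of the Boothby–DeVos–Montejano
classification) or `exists_isKempermanDecompI_of_isPeriodic` (reduction inside the stabiliser to
`FullGroupCriticalPairs`). [cite: Kemperman1960, Thm 5.1] [cite: Grynkiewicz2005, §2 (KST I)]
[cite: Grynkiewicz2009, §2 (KST)] -/
theorem exists_isKempermanDecompI {A B : Finset G} [Nontrivial G] (hA : A.Nonempty)
    (hB : B.Nonempty) (hcrit : #(A + B) + 1 = #A + #B)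
    (hyp : ¬ IsPeriodic (A + B) ∨ ∃ c, A.addConvolution B c = 1) :
    ∃ (H : AddSubgroup G) (A₁ A₀ B₁ B₀ : Finset G), IsKempermanDecompI H A B A₁ A₀ B₁ B₀ := by
  by_cases hp : IsPeriodic (A + B)
  · obtain ⟨c, hc⟩ := hyp.resolve_left (not_not.2 hp)
    exact exists_isKempermanDecompI_of_isPeriodic hA hB hcrit hp hc
  · exact exists_isKempermanDecompI_of_not_isPeriodic hA hB hcrit hp

/-- **Corollary (Kemperman 1960, Lemma 5.2 / the use of KST in Grynkiewicz 2009, Lemma 5.9):** a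
critical pair whose sum is neither periodic nor quasi-periodic is elementary — in a Kemperman
decomposition the periodic part `A₁ + B ∪ (A₀ + B₁)` of `A + B` must then be empty, so
`(A, B) = (A₀, B₀)`.  (Kemperman: «Let `A`, `B` be finite non-empty subsets of `G` satisfying (1)
and (2). Then either the pair `(A, B)` is elementary or `P₁(A, B)` is non-empty»; `P₁(A, B) ≠ ∅`
with `A + B` aperiodic makes `A + B` quasi-periodic.) [cite: Kemperman1960, Lemma 5.2]
[cite: Grynkiewicz2009, Lemma 5.9 (proof: «we can apply KST … Hence H = G»)] -/
theorem isElementaryPair_of_not_isQuasiPeriodic {A B : Finset G} [Nontrivial G] (hA : A.Nonempty)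
    (hB : B.Nonempty) (hcrit : #(A + B) + 1 = #A + #B) (hap : ¬ IsPeriodic (A + B))
    (hnq : ¬ IsQuasiPeriodic (A + B)) : IsElementaryPair A B := by
  obtain ⟨H, A₁, A₀, B₁, B₀, hd⟩ := exists_isKempermanDecompI hA hB hcrit (Or.inl hap)
  have hdA := hd.decomp_left
  have hdB := hd.decomp_right
  set P := A₁ + B ∪ (A₀ + B₁)
  have hsplit : A + B = P ∪ (A₀ + B₀) := add_eq_of_coarse hdA hdB
  have hPper : IsPeriodicWith H P := (hdA.periodic.add_right B).union (hdB.periodic.add_left A₀)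
  by_cases hP : P.Nonempty
  · exfalso
    refine hnq ⟨H, P, A₀ + B₀, ⟨hdA.ne_bot, ?_, hsplit.symm, hPper, ?_⟩, hP⟩
    · rw [disjoint_left]
      intro p hp hc
      exact sub_notMem_of_coarse hdA hdB hd.quot_unique hp hc (by rw [sub_self]; exact H.zero_mem)
    · intro x hx y hy
      obtain ⟨a, ha, b, hb, rfl⟩ := mem_add.1 hx
      obtain ⟨a', ha', b', hb', rfl⟩ := mem_add.1 hy
      rw [add_sub_add_comm]
      exact H.add_mem (hdA.sub_mem a ha a' ha') (hdB.sub_mem b hb b' hb')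
  · rw [not_nonempty_iff_eq_empty, union_eq_empty] at hP
    have hA₁ : A₁ = ∅ := by
      have := hP.1; rw [add_eq_empty] at this
      exact this.resolve_right hB.ne_empty
    have hB₁ : B₁ = ∅ := by
      have := hP.2; rw [add_eq_empty] at this
      exact this.resolve_left hd.left_nonempty.ne_empty
    have hAe : A₀ = A := by have := hdA.union_eq; rwa [hA₁, empty_union] at this
    have hBe : B₀ = B := by have := hdB.union_eq; rwa [hB₁, empty_union] at this
    rw [← hAe, ← hBe]; exact hd.elementary


end KST

/-! ### Kemperman's Theorem 5.1 as an equivalence (the «if» half for `IsKempermanDecompI`)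

The «if» half of KST was proved in `KempermanElementaryPairs.lean` for decompositions in Grynkiewicz's
form `IsKempermanDecomp` (with his condition (iii)); the proofs use only Kemperman's conditions, and are
repeated here for `IsKempermanDecompI`, giving Kemperman's THEOREM 5.1 as one `↔` statement
(`isKempermanDecompI_iff`).  «Necessary and sufficient in order that both (1) and (2) hold is the
existence of … (i) … (ii) … (iii) … (iv)» (Kemperman 1960, p. 79). -/

section Iff

variable {G : Type u} [AddCommGroup G] [DecidableEq G]

namespace IsKempermanDecompI

variable {H : AddSubgroup G} {A B A₁ A₀ B₁ B₀ : Finset G}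

/-- `A + B = (A₁ + B) ∪ (A₀ + B₁) ∪ (A₀ + B₀)`. [cite: Kemperman1960, Thm 5.1 (proof, sufficiency)] -/
theorem add_eq (h : IsKempermanDecompI H A B A₁ A₀ B₁ B₀) :
    A + B = (A₁ + B ∪ (A₀ + B₁)) ∪ (A₀ + B₀) := by
  have hA := h.decomp_left.union_eq
  have hB := h.decomp_right.union_eq
  calc A + B = (A₁ ∪ A₀) + B := by rw [hA]
    _ = A₁ + B ∪ (A₀ + B) := union_add
    _ = A₁ + B ∪ (A₀ + (B₁ ∪ B₀)) := by rw [hB]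
    _ = _ := by rw [add_union, union_assoc]

/-- The part `(A₁ + B) ∪ (A₀ + B₁)` of `A + B` is `H`-periodic («(iii) The complement `A'` of `A₁` in
`A` satisfies `A' + F = A'`»). [cite: Kemperman1960, Thm 5.1 (proof, sufficiency)] -/
theorem isPeriodicWith_part (h : IsKempermanDecompI H A B A₁ A₀ B₁ B₀) :
    IsPeriodicWith H (A₁ + B ∪ (A₀ + B₁)) :=
  (h.decomp_left.periodic.add_right B).union (h.decomp_right.periodic.add_left A₀)

/-- By (ii) of Kemperman, no element of `(A₁ + B) ∪ (A₀ + B₁)` is congruent modulo `H` to an element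
of `A₀ + B₀`. [cite: Kemperman1960, Thm 5.1 (ii)] -/
theorem sub_notMem (h : IsKempermanDecompI H A B A₁ A₀ B₁ B₀) {p c : G}
    (hp : p ∈ A₁ + B ∪ (A₀ + B₁)) (hc : c ∈ A₀ + B₀) : p - c ∉ H := by
  intro hpc
  obtain ⟨a₀, ha₀, b₀, hb₀, rfl⟩ := mem_add.1 hc
  rcases mem_union.1 hp with hp | hp
  · obtain ⟨a₁, ha₁, b, hb, rfl⟩ := mem_add.1 hp
    exact h.decomp_left.sub_notMem ha₁ ha₀
      (h.quot_unique a₁ (h.decomp_left.left_subset ha₁) b hb a₀ ha₀ b₀ hb₀ hpc).1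
  · obtain ⟨a, ha, b₁, hb₁, rfl⟩ := mem_add.1 hp
    exact h.decomp_right.sub_notMem hb₁ hb₀
      (h.quot_unique a (h.decomp_left.right_subset ha) b₁ (h.decomp_right.left_subset hb₁)
        a₀ ha₀ b₀ hb₀ hpc).2

/-- The two parts of `A + B` are disjoint. [cite: Kemperman1960, Thm 5.1 (proof, sufficiency)] -/
theorem disjoint_parts (h : IsKempermanDecompI H A B A₁ A₀ B₁ B₀) :
    Disjoint (A₁ + B ∪ (A₀ + B₁)) (A₀ + B₀) :=
  disjoint_left.2 fun _ hp hc => h.sub_notMem hp hc (by rw [sub_self]; exact H.zero_mem)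

/-- `A₀ + B₀` lies inside one `H`-coset. [cite: Kemperman1960, Thm 5.1 (i)] -/
theorem sub_mem_of_mem_add (h : IsKempermanDecompI H A B A₁ A₀ B₁ B₀) :
    ∀ x ∈ A₀ + B₀, ∀ y ∈ A₀ + B₀, x - y ∈ H := by
  intro x hx y hy
  obtain ⟨a, ha, b, hb, rfl⟩ := mem_add.1 hx
  obtain ⟨a', ha', b', hb', rfl⟩ := mem_add.1 hy
  have e : a + b - (a' + b') = (a - a') + (b - b') := by abel
  rw [e]
  exact H.add_mem (h.decomp_left.sub_mem a ha a' ha') (h.decomp_right.sub_mem b hb b' hb')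

/-- `A + B = ((A₁ + B) ∪ (A₀ + B₁)) ∪ (A₀ + B₀)` is a quasi-periodic decomposition with quasi-period
`H`. [cite: Kemperman1960, Thm 5.1 (proof, sufficiency)] -/
theorem isQuasiPeriodicDecomp_add (h : IsKempermanDecompI H A B A₁ A₀ B₁ B₀) :
    IsQuasiPeriodicDecomp H (A + B) (A₁ + B ∪ (A₀ + B₁)) (A₀ + B₀) where
  ne_bot := h.decomp_left.ne_bot
  disjoint := h.disjoint_parts
  union_eq := h.add_eq.symm
  periodic := h.isPeriodicWith_part
  sub_mem := h.sub_mem_of_mem_add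

/-- `|φ_H(A + B)| = |φ_H((A₁ + B) ∪ (A₀ + B₁))| + 1`. [cite: Kemperman1960, Thm 5.1 (proof,
sufficiency)] -/
theorem cosetCount_add_eq (h : IsKempermanDecompI H A B A₁ A₀ B₁ B₀) :
    cosetCount H (A + B) = cosetCount H (A₁ + B ∪ (A₀ + B₁)) + 1 :=
  h.isQuasiPeriodicDecomp_add.cosetCount_eq (h.left_nonempty.add h.right_nonempty)

/-- **Kemperman's Theorem 5.1, sufficiency, first half: `|A + B| = |A| + |B| − 1`** («It is not
difficult to see that … (i), (ii), (iii), (iv) together imply (1)», p. 79), for decompositions in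
Kemperman's form; the computation of `IsKempermanDecomp.card_add` verbatim.
[cite: Kemperman1960, Thm 5.1 (sufficiency)] -/
theorem card_add (h : IsKempermanDecompI H A B A₁ A₀ B₁ B₀) : #(A + B) + 1 = #A + #B := by
  have hC₀ := h.elementary.card_add
  have hcA := h.decomp_left.card_eq
  have hcB := h.decomp_right.card_eq
  have hsum : #(A + B) = #(A₁ + B ∪ (A₀ + B₁)) + #(A₀ + B₀) := by
    rw [h.add_eq, card_union_of_disjoint h.disjoint_parts]
  by_cases hfin : (H : Set G).Finite
  · obtain ⟨Hf, hHf, -⟩ := exists_finset_carrier hfin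
    have hP := card_eq_cosetCount_mul hHf h.isPeriodicWith_part
    have hA₁ := card_eq_cosetCount_mul hHf h.decomp_left.periodic
    have hB₁ := card_eq_cosetCount_mul hHf h.decomp_right.periodic
    have hii := h.cosetCount_add
    rw [h.cosetCount_add_eq, h.decomp_left.cosetCount_eq h.left_nonempty,
      h.decomp_right.cosetCount_eq h.right_nonempty] at hii
    have hcnt : cosetCount H (A₁ + B ∪ (A₀ + B₁)) = cosetCount H A₁ + cosetCount H B₁ := by omega
    rw [hcnt, add_mul] at hP
    omega
  · have hA₁ : A₁ = ∅ := by
      by_contra hne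
      exact hfin (finite_coe_of_isPeriodicWith h.decomp_left.periodic (nonempty_iff_ne_empty.2 hne))
    have hB₁ : B₁ = ∅ := by
      by_contra hne
      exact hfin (finite_coe_of_isPeriodicWith h.decomp_right.periodic (nonempty_iff_ne_empty.2 hne))
    simp only [hA₁, hB₁, empty_add, add_empty, empty_union, card_empty, zero_add] at hsum hcA hcB
    omega

/-- By (ii), the representations in `A + B` of an element of `A₀ + B₀` all come from `A₀ × B₀`.
[cite: Kemperman1960, Thm 5.1 (ii)] -/
theorem addConvolution_eq (h : IsKempermanDecompI H A B A₁ A₀ B₁ B₀) {a₀ b₀ : G} (ha₀ : a₀ ∈ A₀)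
    (hb₀ : b₀ ∈ B₀) : A.addConvolution B (a₀ + b₀) = A₀.addConvolution B₀ (a₀ + b₀) := by
  rw [addConvolution_eq_card_filter, addConvolution_eq_card_filter]
  congr 1
  ext b
  simp only [mem_filter]
  constructor
  · rintro ⟨hb, hab⟩
    have hq := h.quot_unique (a₀ + b₀ - b) hab b hb a₀ ha₀ b₀ hb₀
      (by rw [sub_add_cancel, sub_self]; exact H.zero_mem)
    exact ⟨h.decomp_right.mem_right_of_sub_mem hb hb₀ hq.2,
      h.decomp_left.mem_right_of_sub_mem hab ha₀ hq.1⟩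
  · rintro ⟨hb, hab⟩
    exact ⟨h.decomp_right.right_subset hb, h.decomp_left.right_subset hab⟩

/-- If `(A₀, B₀)` has type (IV), then `A + B` is not periodic (the argument of
`IsKempermanDecomp.not_isPeriodic_add` verbatim: a period in `H` would be a period of the punctured
coset `A₀ + B₀`, a period outside `H` would make `A₀ + B₀` `H`-periodic).
[cite: Kemperman1960, Thm 5.1 (proof, sufficiency: «(2) holds»)] -/
theorem not_isPeriodic_add (h : IsKempermanDecompI H A B A₁ A₀ B₁ B₀) (hIV : IsElementaryIV A₀ B₀) :
    ¬ IsPeriodic (A + B) := by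
  have hC₀ := hIV.not_isPeriodic_add
  rintro ⟨K, hK, hper⟩
  obtain ⟨k, hkK, hk0⟩ : ∃ k ∈ K, k ≠ (0 : G) := by
    by_contra hne
    push Not at hne
    exact hK ((AddSubgroup.eq_bot_iff_forall _).2 hne)
  have hC₀ne : (A₀ + B₀).Nonempty := h.left_nonempty.add h.right_nonempty
  have hkAB : ∀ c ∈ A₀ + B₀, ∀ k' ∈ K, k' + c ∈ A + B := fun c hc k' hk' =>
    hper.add_mem hk' (by rw [h.add_eq]; exact mem_union_right _ hc)
  have hmemC₀ : ∀ z ∈ A + B, ∀ c ∈ A₀ + B₀, z - c ∈ H → z ∈ A₀ + B₀ := by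
    intro z hz c hc hzc
    rw [h.add_eq, mem_union] at hz
    exact hz.resolve_left fun hp => h.sub_notMem hp hc hzc
  by_cases hkH : k ∈ H
  · have hsub : k +ᵥ (A₀ + B₀) ⊆ A₀ + B₀ := by
      intro w hw
      obtain ⟨c, hc, rfl⟩ := mem_vadd_finset.1 hw
      exact hmemC₀ _ (hkAB c hc k hkK) c hc (by rw [vadd_eq_add, add_sub_cancel_right]; exact hkH)
    have heq : k +ᵥ (A₀ + B₀) = A₀ + B₀ := eq_of_subset_of_card_le hsub (by rw [card_vadd_finset])
    refine hC₀ ⟨AddSubgroup.zmultiples k, ?_, isPeriodicWith_zmultiples_of_vadd_eq heq⟩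
    rw [Ne, AddSubgroup.zmultiples_eq_bot]
    exact hk0
  · obtain ⟨c, hc⟩ := hC₀ne
    have hkc : k + c ∈ A₁ + B ∪ (A₀ + B₁) := by
      have := hkAB c hc k hkK
      rw [h.add_eq, mem_union] at this
      refine this.resolve_right fun hkc => hkH ?_
      have := h.sub_mem_of_mem_add _ hkc c hc
      rwa [add_sub_cancel_right] at this
    have hall : ∀ x ∈ H, x + c ∈ A₀ + B₀ := by
      intro x hx
      have h1 : x + (k + c) ∈ A₁ + B ∪ (A₀ + B₁) := h.isPeriodicWith_part.add_mem hx hkc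
      have h2 : -k + (x + (k + c)) ∈ A + B :=
        hper.add_mem (K.neg_mem hkK) (by rw [h.add_eq]; exact mem_union_left _ h1)
      have e : -k + (x + (k + c)) = x + c := by abel
      rw [e] at h2
      exact hmemC₀ _ h2 c hc (by rw [add_sub_cancel_right]; exact hx)
    have hperC₀ : IsPeriodicWith H (A₀ + B₀) := by
      intro x hx
      refine eq_of_subset_of_card_le (fun w hw => ?_) (by rw [card_vadd_finset])
      obtain ⟨c', hc', rfl⟩ := mem_vadd_finset.1 hw
      have e : x +ᵥ c' = (x + (c' - c)) + c := by rw [vadd_eq_add]; abel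
      rw [e]
      exact hall _ (H.add_mem hx (h.sub_mem_of_mem_add c' hc' c hc))
    exact hC₀ ⟨H, h.decomp_left.ne_bot, hperC₀⟩

/-- **Kemperman's Theorem 5.1, sufficiency, second half: (2)** — `A + B` is aperiodic or has an
element `c` with `ν_c(A, B) = 1` (a unique expression element of the elementary pair of type
(I)–(III) is one of `A + B` by (ii); for type (IV) `A + B` is not periodic).
[cite: Kemperman1960, Thm 5.1 (sufficiency)] -/
theorem not_isPeriodic_or_exists (h : IsKempermanDecompI H A B A₁ A₀ B₁ B₀) :
    ¬ IsPeriodic (A + B) ∨ ∃ x, A.addConvolution B x = 1 := by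
  rcases h.elementary.exists_addConvolution_eq_one_or with ⟨a₀, ha₀, b₀, hb₀, h1⟩ | hIV
  · exact Or.inr ⟨a₀ + b₀, by rw [h.addConvolution_eq ha₀ hb₀]; exact h1⟩
  · exact Or.inl (h.not_isPeriodic_add hIV)

end IsKempermanDecompI

/-- **KEMPERMAN 1960, THEOREM 5.1** (finite nontrivial abelian `G`, `A, B ≠ ∅`): «Let `A`, `B` be
finite non-empty subsets of `G` satisfying (1) and, moreover, (2) … Necessary and sufficient in order
that both (1) and (2) hold is the existence of a non-empty subset `A₁` of `A`, a non-empty subset `B₁`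
of `B` and a subgroup `F` of `G` of order `|F| ≥ 2`, such that: (i) The pair `(A₁, B₁)` is
elementary, each of `A₁, B₁` is contained in an `F`-coset. (ii) … only representation … (iii) … (iv)
`|σA + σB| = |σA| + |σB| − 1`» — with (1) in the form `|A + B| = |A| + |B| − 1` (Grynkiewicz 2005
«KST I»; Kemperman's (1) with `≤` is equivalent given (2), by Kneser / Kemperman–Scherk) and (2) as
«`A + B` aperiodic or `ν_c(A, B) = 1` for some `c`».  `→`: `exists_isKempermanDecompI`; `←`:
`IsKempermanDecompI.card_add`, `IsKempermanDecompI.not_isPeriodic_or_exists` (valid in every abelian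
group). [cite: Kemperman1960, Thm 5.1] [cite: Grynkiewicz2005, §2 (KST I)] -/
theorem isKempermanDecompI_iff [Fintype G] [Nontrivial G] {A B : Finset G} (hA : A.Nonempty)
    (hB : B.Nonempty) :
    (#(A + B) + 1 = #A + #B ∧ (¬ IsPeriodic (A + B) ∨ ∃ c, A.addConvolution B c = 1)) ↔
      ∃ (H : AddSubgroup G) (A₁ A₀ B₁ B₀ : Finset G), IsKempermanDecompI H A B A₁ A₀ B₁ B₀ := by
  constructor
  · rintro ⟨hcrit, hyp⟩
    exact exists_isKempermanDecompI hA hB hcrit hyp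
  · rintro ⟨H, A₁, A₀, B₁, B₀, h⟩
    exact ⟨h.card_add, h.not_isPeriodic_or_exists⟩

end Iff

end Literature.Combinatorics.Additive
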